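import Mathlib
import Summits.ResolutionOfSingularities.ResolutionOfSingularities.Theorems.WeightedInvariantLocalWeightedDropPolyDescentSelDefs

/-!
# `WeightedInvariant.LocalWeightedDrop`, the monic polyhedron descent WITH A PREPARATION SELECTOR (ρ-T′, part 2: `β` IS NON-INCREASING, THE
# β-NEUTRAL TAIL, THE RE-CENTRED STRAIGHTENED LABELS `Â m`)

Crux item stmt-ResolutionOfSingularities-8899 `LocalWeightedDrop` (route `ResolutionOfSingularities/WeightedInvariant`), ENGINE skeleton v32
(ddb48572591139d5), registered stub `stub_spaceNCRankDrop`; TOT2-LINE v1.2 (`L/res-L1-w43-lead-1/g4/TOT2-LINE.md`), inner assembly, QUESTION Q6 of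
res-L1-w43-lead-1 (13:56Z, «old component = maximal-contact plane»: in the sub-regime `y ∈ O` the label has `A₀ = 0` and must NEVER be re-centred, but
`PolyDescent.succT` re-centres by the `ε`-chosen `prepPsi` after every shear) and res-type-056's CHECK (14:00Z, «does ρ-T accept the identity
re-centring on well-prepared labels?»).  [OURS · L1 W4.3 · chain w43 · stub worker res-L1-w43-stub-2 (gen 5); a SELECTOR-GENERIC PORT of the lead
prover's ρ-T files …PolyDescentShearBeta / …PolyDescentTail / …PolyDescentNoChain / …PolyDescentRegimeRank (res-L1-w43-lead-1 gen 3/4), whose proofs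
use `prepPsi` only through its well-preparing property; MODEL Cossart–Jannsen–Saito LNM 2270 Ch. 8/11–13 for `J = (y^d + Σ_{j<d} A_j y^j)`, `e = 2`.
Nothing here is a statement of any manuscript; the games are the programme's own; AI-produced, gate-checked, weaker than expert review.]

Verbatim ports, `prep d X` ↦ `shift d X (ψsel X)` and `isPrepRecentring_prepPsi (hprep …)` ↦ `hsel …`, of `betaL_succT_le` / `exists_neutral_tailT`
(…PolyDescentShearBeta) and of the `section Tail` of …PolyDescentTail (`pointStep_cases/shape`, `succ_eq_divOneT`, `alphaL_succ_of_not_isPointStepT`,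
`exists_isPointStepT_ge`, `isPosT_Slab`, `prep_Slab`, `Ahat_eq`, `Ahat_spec`, `isPermissibleOneT_Ahat_of_not_isPointStepT`, `epsL_Ahat_lt_of_isPointStepT`),
for an ADMISSIBLE selector `hsel : ∀ X, IsPosT d X → IsPrepRecentring d X (ψsel X)`; the generic bookkeeping `ptIdx` / `hser` and `IsPointStepT` are
imported unchanged.
-/

set_option linter.dupNamespace false -- mandated namespace of this single-conjunct summit

noncomputable section

namespace Summit.ResolutionOfSingularities.ResolutionOfSingularities.Theorems

namespace PolyDescent

open MvPowerSeries MonicDescent WildMonic Literature.RingTheory.TwoVariableSeries Literature.AlgebraicGeometry.Resolution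

variable {k : Type} [Field k]

/-! ## PART 3: `β` along the selector strategy (port of …PolyDescentShearBeta §3) -/

section Beta

variable {d : ℕ} {ψsel : (Fin d → MvPowerSeries (Fin 2) k) → MvPowerSeries (Fin 2) k}
  (hsel : ∀ X : Fin d → MvPowerSeries (Fin 2) k, IsPosT d X → IsPrepRecentring d X (ψsel X))
  (hmin : ∀ (B : Fin d → MvPowerSeries (Fin 2) k) (ψ : MvPowerSeries (Fin 2) k), WellPrepared d B → IsPosT d B → constantCoeff ψ = 0 →
    ∀ w : Fin 2 → ℕ, (∀ i, 0 < w i) → ∀ P ∈ newtonSet B, ∃ Q ∈ newtonSet (shift d B ψ), Finsupp.weight w Q ≤ Finsupp.weight w P)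
include hsel hmin

/-- `β` IS NON-INCREASING ALONG THE SELECTOR STRATEGY (given an admissible selector and (ρ-M)), and the β-neutral steps are classified
(verbatim `betaL_succT_le`). -/
theorem betaL_succTSel_le (A : Fin d → MvPowerSeries (Fin 2) k) (hWP : WellPrepared d A) (hpos : IsPosT d A)
    (hne : (newtonSet A).Nonempty) (A' : Fin d → MvPowerSeries (Fin 2) k) (hA' : A' ∈ succTSel d ψsel A) :
    betaL (newtonSet A') ≤ betaL (newtonSet A) ∧ (betaL (newtonSet A') = betaL (newtonSet A) → IsNeutralStepSel d ψsel A A') := by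
  have hL : 0 < d.factorial := Nat.factorial_pos d
  have hsum := factorial_le_sum_of_isPosT hpos
  have hsum1 := factorial_lt_sum_of_isPosT hpos
  by_cases h1 : IsPermissibleOneT d A
  · rw [succTSel_of_isPermissibleOneT _ h1] at hA'
    rcases hA' with rfl
    rw [newtonSet_divOneT A h1, betaL_image_shift (shiftOneF_fst h1) (shiftOneF_snd d A) hne]
    exact ⟨le_rfl, fun _ => Or.inl ⟨h1, rfl⟩⟩
  by_cases h2 : IsPermissibleTwoT d A
  · rw [succTSel_of_isPermissibleTwoT _ h1 h2] at hA'
    rcases hA' with rfl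
    have hβ := betaL_image_shift₂_add (shiftTwoF_fst d A) (shiftTwoF_snd h2) hne
    rw [newtonSet_divTwoT A h2]
    exact ⟨by omega, fun h => by omega⟩
  by_cases h3 : HasGraphCurveT d A
  · rw [succTSel_of_hasGraphCurveT _ h1 h2 h3] at hA'
    rcases hA' with rfl
    set h := graphShearT d A with hh
    obtain ⟨ψ', -, hψ'0, hperm'⟩ := graphShearT_spec h3
    have hposS : IsPosT d (shearT h A) := isPosT_shearT h hpos
    have hprepS : IsPrepRecentring d (shearT h A) (ψsel (shearT h A)) := hsel _ hposS
    obtain ⟨hneB, hαB, hβB⟩ := alphaL_betaL_prep_shearT hmin hWP hne hprepS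
    have hperm : IsPermissibleTwoT d (shift d (shearT h A) (ψsel (shearT h A))) :=
      isPermissibleTwoT_of_wellPrepared_shift hmin hperm' hprepS.1 hψ'0 hprepS.2.2.1 hprepS.2.1
    have hβ := betaL_image_shift₂_add (shiftTwoF_fst d _) (shiftTwoF_snd hperm) hneB
    rw [newtonSet_divTwoT _ hperm]
    rw [hβB] at hβ
    exact ⟨by omega, fun h => by omega⟩
  -- the point move
  rw [succTSel_of_point _ h1 h2 h3] at hA'
  have hα : alphaL (newtonSet A) < d.factorial := alphaL_lt_factorial_of_not_isPermissibleOneT h1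
  rcases hA' with (rfl | rfl) | ⟨c, hc0, rfl⟩
  · rw [newtonSet_blowOneT A hpos]
    exact ⟨betaL_image_psiC_le hsum hne, fun _ => Or.inr ⟨h1, h2, h3, Or.inl rfl⟩⟩
  · rw [newtonSet_blowTwoT A hpos, betaL_image_phiEC hsum hne]
    obtain ⟨P, hP, hP0, hP1⟩ := exists_eq_betaL hne
    have h3P := hsum1 P hP
    rw [hP0, hP1] at h3P
    exact ⟨by omega, fun h => by omega⟩
  · have hposS : IsPosT d (shearT (C c) A) := isPosT_shearT (C c) hpos
    have hprepS : IsPrepRecentring d (shearT (C c) A) (ψsel (shearT (C c) A)) := hsel _ hposS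
    obtain ⟨hneB, hαB, hβB⟩ := alphaL_betaL_prep_shearT hmin hWP hne hprepS
    have hposB : IsPosT d (shift d (shearT (C c) A) (ψsel (shearT (C c) A))) := hprepS.2.1
    have hsumB := factorial_le_sum_of_isPosT hposB
    refine ⟨?_, fun _ => Or.inr ⟨h1, h2, h3, Or.inr ⟨c, hc0, rfl⟩⟩⟩
    rw [newtonSet_blowOneT _ hposB]
    exact le_trans (betaL_image_psiC_le hsumB hneB) hβB.le

/-- β-STABILISATION along an infinite selector chain of well-prepared positions with non-empty Newton set. -/
theorem exists_neutral_tailSel (A : ℕ → (Fin d → MvPowerSeries (Fin 2) k))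
    (hA : ∀ m, WellPrepared d (A m) ∧ IsPosT d (A m) ∧ (newtonSet (A m)).Nonempty ∧ A (m + 1) ∈ succTSel d ψsel (A m)) :
    ∃ M : ℕ, ∀ m, M ≤ m → betaL (newtonSet (A m)) = betaL (newtonSet (A M)) ∧ IsNeutralStepSel d ψsel (A m) (A (m + 1)) := by
  set f : ℕ → ℕ := fun m => betaL (newtonSet (A m)) with hf
  have hstep : ∀ m, f (m + 1) ≤ f m ∧ (f (m + 1) = f m → IsNeutralStepSel d ψsel (A m) (A (m + 1))) := by
    intro m
    obtain ⟨hwp, hpos, hne, hsucc⟩ := hA m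
    exact betaL_succTSel_le hsel hmin (A m) hwp hpos hne (A (m + 1)) hsucc
  have hanti : ∀ m n, m ≤ n → f n ≤ f m := by
    intro m n hmn
    induction n, hmn using Nat.le_induction with
    | base => exact le_rfl
    | succ n _ ih => exact le_trans (hstep n).1 ih
  obtain ⟨M, hM⟩ : ∃ M, ∀ n, f M ≤ f n := by
    have hne : (Set.range f).Nonempty := ⟨f 0, 0, rfl⟩
    obtain ⟨M, hMv⟩ : sInf (Set.range f) ∈ Set.range f := Nat.sInf_mem hne
    exact ⟨M, fun n => by rw [hMv]; exact Nat.sInf_le ⟨n, rfl⟩⟩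
  refine ⟨M, fun m hm => ?_⟩
  have hfm : f m = f M := le_antisymm (hanti M m hm) (hM m)
  have hfm1 : f (m + 1) = f M := le_antisymm (hanti M (m + 1) (by omega)) (hM (m + 1))
  exact ⟨hfm, (hstep m).2 (by rw [hfm1, hfm])⟩

end Beta

/-! ## PART 4: the β-neutral tail of a selector chain (port of …PolyDescentTail §2–§3) -/

section Tail

variable {d : ℕ} {ψsel : (Fin d → MvPowerSeries (Fin 2) k) → MvPowerSeries (Fin 2) k} (A : ℕ → (Fin d → MvPowerSeries (Fin 2) k))
  (hsel : ∀ X : Fin d → MvPowerSeries (Fin 2) k, IsPosT d X → IsPrepRecentring d X (ψsel X))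
  (hmin : ∀ (B : Fin d → MvPowerSeries (Fin 2) k) (ψ : MvPowerSeries (Fin 2) k), WellPrepared d B → IsPosT d B → constantCoeff ψ = 0 →
    ∀ w : Fin 2 → ℕ, (∀ i, 0 < w i) → ∀ P ∈ newtonSet B, ∃ Q ∈ newtonSet (shift d B ψ), Finsupp.weight w Q ≤ Finsupp.weight w P)
  (hA : ∀ m, WellPrepared d (A m) ∧ IsPosT d (A m) ∧ (newtonSet (A m)).Nonempty ∧ IsNeutralStepSel d ψsel (A m) (A (m + 1)))

include hA in
/-- At a curve step the next label is `A m / u₁^{d−·}`. -/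
theorem succ_eq_divOneT_sel {m : ℕ} (hm : ¬ IsPointStepT A m) : A (m + 1) = divOneT d (A m) := by
  unfold IsPointStepT at hm
  push Not at hm
  rcases (hA m).2.2.2 with ⟨-, h⟩ | ⟨h1, -⟩
  · exact h
  · exact absurd hm h1

include hA in
/-- At a point step: no axis curve, no graph curve, and the next label is `blowOneT (A m)` or `blowOneT (shift (shearT (C c) (A m)) (ψsel _))`, `c ≠ 0`. -/
theorem pointStepSel_cases {m : ℕ} (hm : IsPointStepT A m) :
    ¬ IsPermissibleOneT d (A m) ∧ ¬ IsPermissibleTwoT d (A m) ∧ ¬ HasGraphCurveT d (A m) ∧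
      ∃ c : k, (c = 0 ∧ A (m + 1) = blowOneT d (A m)) ∨
        (c ≠ 0 ∧ A (m + 1) = blowOneT d (shift d (shearT (C c) (A m)) (ψsel (shearT (C c) (A m))))) := by
  rcases (hA m).2.2.2 with ⟨h1, -⟩ | ⟨h1, h2, h3, h⟩
  · exact absurd h1 hm
  · refine ⟨h1, h2, h3, ?_⟩
    rcases h with h | ⟨c, hc, h⟩
    · exact ⟨0, Or.inl ⟨rfl, h⟩⟩
    · exact ⟨c, Or.inr ⟨hc, h⟩⟩

include hsel hA in
/-- UNIFIED POINT-STEP SHAPE: `A (m+1) = blowOneT Q` with `Q` a position re-centring `shearT (C λ_m) (A m)` by some `ψ` without constant term. -/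
theorem pointStepSel_shape {m : ℕ} (hm : IsPointStepT A m) :
    ∃ ψ : MvPowerSeries (Fin 2) k, constantCoeff ψ = 0 ∧ IsPosT d (shift d (shearT (C (paramSel ψsel A m)) (A m)) ψ) ∧
      A (m + 1) = blowOneT d (shift d (shearT (C (paramSel ψsel A m)) (A m)) ψ) := by
  obtain ⟨-, -, -, c, hc⟩ := pointStepSel_cases A hA hm
  by_cases hex' : ∃ c : k, c ≠ 0 ∧ A (m + 1) = blowOneT d (shift d (shearT (C c) (A m)) (ψsel (shearT (C c) (A m))))
  · have hparam : paramSel ψsel A m = Classical.choose hex' := by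
      unfold paramSel; rw [dif_pos ⟨hm, hex'⟩]
    obtain ⟨-, hAeq⟩ := Classical.choose_spec hex'
    rw [← hparam] at hAeq
    obtain ⟨hψ0, hpos, -, -⟩ := hsel _ (isPosT_shearT (C (paramSel ψsel A m)) (hA m).2.1)
    exact ⟨_, hψ0, hpos, hAeq⟩
  · have hparam : paramSel ψsel A m = 0 := by
      unfold paramSel; rw [dif_neg (fun h => hex' h.2)]
    rcases hc with ⟨-, hAeq⟩ | ⟨hcne, hAeq⟩
    · refine ⟨0, map_zero _, ?_, ?_⟩
      · rw [hparam, map_zero, shearT_zero, shift_zero']; exact (hA m).2.1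
      · rw [hAeq, hparam, map_zero, shearT_zero, shift_zero']
    · exact absurd ⟨c, hcne, hAeq⟩ hex'

include hA in
/-- `α` drops by exactly `d!` at a curve step. -/
theorem alphaL_succ_of_not_isPointStepT_sel {m : ℕ} (hm : ¬ IsPointStepT A m) :
    alphaL (newtonSet (A (m + 1))) + d.factorial = alphaL (newtonSet (A m)) := by
  have hP1 : IsPermissibleOneT d (A m) := by unfold IsPointStepT at hm; push Not at hm; exact hm
  rw [succ_eq_divOneT_sel A hA hm, newtonSet_divOneT (A m) hP1, alphaL_image_shift_add (shiftOneF_fst hP1) (hA m).2.2.1]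

include hA in
/-- INFINITELY MANY POINT STEPS: a run of curve steps lowers `α` by `d!` each time. -/
theorem exists_isPointStepT_ge_sel (m : ℕ) : ∃ n, m ≤ n ∧ IsPointStepT A n := by
  by_contra h
  push Not at h
  have hdec : ∀ j, alphaL (newtonSet (A (m + j))) + d.factorial * j = alphaL (newtonSet (A m)) := by
    intro j
    induction j with
    | zero => simp
    | succ j ih =>
      have hstep := alphaL_succ_of_not_isPointStepT_sel A hA (h (m + j) (by omega))
      rw [show m + (j + 1) = m + j + 1 from by omega, Nat.mul_succ]
      omega
  have := hdec (alphaL (newtonSet (A m)) + 1)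
  have h1 : alphaL (newtonSet (A m)) + 1 ≤ d.factorial * (alphaL (newtonSet (A m)) + 1) :=
    Nat.le_mul_of_pos_left _ (Nat.factorial_pos d)
  omega

section Hat

variable (hex : ∀ m, ∃ n, m ≤ n ∧ IsPointStepT A n)

include hA in
/-- `S m` is a position. -/
theorem isPosT_SlabSel (m : ℕ) : IsPosT d (SlabSel ψsel A hex m) := isPosT_shearT _ (hA m).2.1

include hsel hA in
/-- The selected re-centring of `S m` is well-preparing. -/
theorem prep_SlabSel (m : ℕ) : IsPrepRecentring d (SlabSel ψsel A hex m) (ψsel (SlabSel ψsel A hex m)) :=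
  hsel _ (isPosT_SlabSel A hA hex m)

/-- `Â m` is `S m` re-centred by the selected re-centring. -/
theorem AhatSel_eq (m : ℕ) : AhatSel ψsel A hex m = shift d (SlabSel ψsel A hex m) (ψsel (SlabSel ψsel A hex m)) := rfl

include hsel hmin hA in
/-- `Â m` is a well-prepared position with non-empty Newton set and the same `α`, `β` as `A m`. -/
theorem AhatSel_spec (m : ℕ) :
    WellPrepared d (AhatSel ψsel A hex m) ∧ IsPosT d (AhatSel ψsel A hex m) ∧ (newtonSet (AhatSel ψsel A hex m)).Nonempty ∧
      alphaL (newtonSet (AhatSel ψsel A hex m)) = alphaL (newtonSet (A m)) ∧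
      betaL (newtonSet (AhatSel ψsel A hex m)) = betaL (newtonSet (A m)) := by
  have hpr := prep_SlabSel A hsel hA hex m
  obtain ⟨hne, hα, hβ⟩ := alphaL_betaL_prep_shearT hmin (hA m).1 (hA m).2.2.1 hpr
  exact ⟨hpr.2.2.1, hpr.2.1, hne, hα, hβ⟩

include hsel hmin hA in
/-- At a curve step `Â m` is `V(y,u₁)`-permissible as well. -/
theorem isPermissibleOneT_AhatSel_of_not_isPointStepT {m : ℕ} (hm : ¬ IsPointStepT A m) : IsPermissibleOneT d (AhatSel ψsel A hex m) := by
  have hP1 : IsPermissibleOneT d (A m) := by unfold IsPointStepT at hm; push Not at hm; exact hm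
  apply isPermissibleOneT_of_factorial_le_alphaL
  rw [(AhatSel_spec A hsel hmin hA hex m).2.2.2.1]
  obtain ⟨P, hP, hP0⟩ := exists_eq_alphaL (hA m).2.2.1
  rw [← hP0]
  exact factorial_le_fst_of_isPermissibleOneT hP1 P hP

include hsel hA in
/-- At a point step `ε(Â m) < d!` (else a graph curve, excluded at point steps). -/
theorem epsL_AhatSel_lt_of_isPointStepT {m : ℕ} (hm : IsPointStepT A m) : epsL (newtonSet (AhatSel ψsel A hex m)) < d.factorial := by
  by_contra hge
  push Not at hge
  have hperm : IsPermissibleTwoT d (AhatSel ψsel A hex m) := isPermissibleTwoT_of_factorial_le_epsL hge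
  exact (pointStepSel_cases A hA hm).2.2.1
    ⟨hser (IsPointStepT A) (paramSel ψsel A) hex m, ψsel (SlabSel ψsel A hex m), hser_noY _ _ hex m, (prep_SlabSel A hsel hA hex m).1, hperm⟩

end Hat

end Tail


end PolyDescent

end Summit.ResolutionOfSingularities.ResolutionOfSingularities.Theorems

end
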